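import Summits.CriticalPhenomena.PercolationContinuityZ3.Theorems.PercNearOneGluingNoHeavyLowerTailSahiTwoLevelRecursiveAbsorbing
import Summits.CriticalPhenomena.PercolationContinuityZ3.Theorems.PercNearOneGluingNoHeavyLowerTailSahiTwoLevelIndependentTopsC3
import Mathlib.Tactic.Linarith
import HarnessLib

/-!
# Kahn's inequality on the RECURSIVELY-CERTIFIED class: absorbing head, one shared coin, inessential coordinate, top-absorbing coordinate,
# or a coordinate whose sections lie in a solved face — recursively

Support file of the one-cut programme (crux `NoHeavyLowerTail`, stmt-CriticalPhenomena-4575; master-family line P2, seat `prim-masterthm-p2` gen 21;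
memo `run/shared/lean/prim/prim-masterthm/FROM-prim-masterthm-p2-g21-TOP-ABSORBING.md` §8).  No definition, no sorry; axioms standard.
Extends `…SahiTwoLevelRecursiveAbsorbing.sahiE3_nonneg_of_recursivelyAbsorbing` by two more certificates, both already KERNEL:

* (d) two of the three members are determined by coordinate sets sharing AT MOST ONE coin — Kahn's inequality holds outright
  (bnk-2, `SahiTwoLevelIndep.prodBernoulli_sahiE3_nonneg_of_card_inter_le_one`);
* (g) a coordinate `e ∈ S` whose pair of sections `(G,H) = (U^{e←1}, U^{e←0})` lies in a SOLVED FACE of the two-level top law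
  (`SahiTwoLevelVariational.InSolvedFace`: W-face / costless-inside / independent pair of tops / `κ₃(G) ≥ 0` / idle slot with nonnegative bracket,
  over the three slot rotations — lane bnk-2's theorems packaged in gen 20), provided `P (S.erase e)` holds for all EIGHT mixed section triples
  (so that `E_3 ≥ 0` for them is available by recursion: `topForm_nonneg_of_inSolvedFace`), then P1's weak local step.

`sahiE3_nonneg_of_recursivelyCertified`: every predicate `P S U` that always certifies one of (a) absorbing head [P3], (d), (b) inessential coordinate,
(c) top-absorbing coordinate, (g) solved-face coordinate — recursively — gives `E_3(μ_q; U) ≥ 0` for every increasing triple determined by `S`.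
CENSUS (code/gen21/classKcomb.py, the bias-free sub-recursion {(a),(d),(b),(c), independent tops, W, costless-inside}): contains every triple examined on
≤ 5 coins (3 coins: all 1 540; 4: 2·10⁵; 5: 1.1·10⁶ random) and all but ≈ 3·10⁻⁵ / 2·10⁻⁴ of random triples on 6 / 7 coins; with the bias-dependent faces
(κ₃, idle bracket) and the fill bounds added at each coordinate, every examined triple on ≤ 7 coins (memo §8).
HONEST LABEL: Kahn's Conjecture 5 / `SahiTwoLevelPlus` remain OPEN; this is Kahn's inequality on a recursively defined class. [this work]
-/

noncomputable section

open scoped Classical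

namespace Summit.CriticalPhenomena.PercolationContinuityZ3.Theorems

namespace SahiTwoLevelVariational

open Finset Function MeasureTheory
open Literature.Combinatorics.Sahi2008
open Literature.Probability.LatticeModels (prodBernoulli prodBernoulli_harris sahiE3 sahiE3_def sahiE3_comm₁₂ sahiE3_comm₂₃)
open Literature.Probability.Percolation (DeterminedBy determinedBy_iff)
open Literature.Probability.Percolation.DecisionTree (ind ind_of_mem ind_of_not_mem ind_nonneg)
open SahiCoordinateBernstein (coordPiece₂)

variable {κ : Type} [Fintype κ]

omit [Fintype κ] in
/-- The triple of `b`-sections of a triple along `e`. [this work] -/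
theorem secTriple_apply (e : κ) (b : Bool) (U : Fin 3 → Set (Set κ)) (i : Fin 3) :
    (![secAt e b (U 0), secAt e b (U 1), secAt e b (U 2)] : Fin 3 → Set (Set κ)) i = secAt e b (U i) := by
  fin_cases i <;> rfl

/-- **A SOLVED-FACE COORDINATE IS A GOOD COORDINATE.**  If the pair of sections of an increasing triple along `e` lies in a solved face of the
two-level top law and `E_3 ≥ 0` holds for every triple drawn from the six section events, then `E_3(μ_q; A, B, C) ≥ 0`. [this work] -/
theorem sahiE3_nonneg_of_solvedFaceAt (q : κ → unitInterval) (e : κ) (U : Fin 3 → Set (Set κ)) (hU : ∀ i, IsUpperSet (U i))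
    (hface : InSolvedFace q ![secAt e true (U 0), secAt e true (U 1), secAt e true (U 2)]
      ![secAt e false (U 0), secAt e false (U 1), secAt e false (U 2)])
    (hE : MixedE3Nonneg q ![secAt e true (U 0), secAt e true (U 1), secAt e true (U 2)]
      ![secAt e false (U 0), secAt e false (U 1), secAt e false (U 2)]) :
    0 ≤ sahiE3 (prodBernoulli q) (U 0) (U 1) (U 2) := by
  set G : Fin 3 → Set (Set κ) := ![secAt e true (U 0), secAt e true (U 1), secAt e true (U 2)] with hGdef
  set H : Fin 3 → Set (Set κ) := ![secAt e false (U 0), secAt e false (U 1), secAt e false (U 2)] with hHdef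
  have hGup : ∀ i, IsUpperSet (G i) := fun i => by
    rw [hGdef, secTriple_apply]; exact isUpperSet_secAt e true (hU i)
  have hHup : ∀ i, IsUpperSet (H i) := fun i => by
    rw [hHdef, secTriple_apply]; exact isUpperSet_secAt e false (hU i)
  have hHG : ∀ i, H i ⊆ G i := fun i => by
    rw [hGdef, hHdef, secTriple_apply, secTriple_apply]; exact SahiTwoLevel.secAt_false_subset_true e (hU i)
  have hT : 0 ≤ topForm q G H := topForm_nonneg_of_inSolvedFace q G H hGup hHup hHG hE hface
  have h1 : 0 ≤ sahiE3 (prodBernoulli q) (secAt e true (U 0)) (secAt e true (U 1)) (secAt e true (U 2)) := by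
    have := hE G fun i => ⟨i, Or.inl rfl⟩
    simpa [hGdef] using this
  have h0 : 0 ≤ sahiE3 (prodBernoulli q) (secAt e false (U 0)) (secAt e false (U 1)) (secAt e false (U 2)) := by
    have := hE H fun i => ⟨i, Or.inr rfl⟩
    simpa [hHdef] using this
  rw [← sahiE_three_ind] at h0 h1 ⊢
  have hb := SahiTwoLevel.coordPiece₂_add_eq_twoLevelPlus q e (U 0) (U 1) (U 2)
  simp only [ex_bernoulliWeight_ind] at hb
  have hW : 0 ≤ coordPiece₂ q e ![U 0, U 1, U 2]
      + sahiE (bernoulliWeight q) 3 ![ind (secAt e false (U 0)), ind (secAt e false (U 1)), ind (secAt e false (U 2))]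
      + sahiE (bernoulliWeight q) 3 ![ind (secAt e true (U 0)), ind (secAt e true (U 1)), ind (secAt e true (U 2))] := by
    rw [hb]
    simpa [topForm, hGdef, hHdef] using hT
  exact SahiCoSunflowerTwoLevel.sahiE_three_nonneg_of_weakTwoLevelAt q e (hU 0) (hU 1) (hU 2) hW h0 h1

/-- **Kahn's inequality when two members share at most one coin, any two slots** (bnk-2's theorem plus the symmetry of `E_3`). [this work] -/
theorem sahiE3_nonneg_of_sharedLeOne (q : κ → unitInterval) (U : Fin 3 → Set (Set κ)) (hU : ∀ i, IsUpperSet (U i))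
    (T₀ T₁ : Finset κ) (hT : (T₀ ∩ T₁).card ≤ 1)
    (hdet : (DeterminedBy (U 0) (↑T₀ : Set κ) ∧ DeterminedBy (U 1) (↑T₁ : Set κ))
      ∨ (DeterminedBy (U 1) (↑T₀ : Set κ) ∧ DeterminedBy (U 2) (↑T₁ : Set κ))
      ∨ (DeterminedBy (U 0) (↑T₀ : Set κ) ∧ DeterminedBy (U 2) (↑T₁ : Set κ))) :
    0 ≤ sahiE3 (prodBernoulli q) (U 0) (U 1) (U 2) := by
  rcases hdet with ⟨h0, h1⟩ | ⟨h1, h2⟩ | ⟨h0, h2⟩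
  · exact SahiTwoLevelIndep.prodBernoulli_sahiE3_nonneg_of_card_inter_le_one q (hU 0) (hU 1) (hU 2) h0 h1 hT
  · rw [sahiE3_comm₁₂, sahiE3_comm₂₃]
    exact SahiTwoLevelIndep.prodBernoulli_sahiE3_nonneg_of_card_inter_le_one q (hU 1) (hU 2) (hU 0) h1 h2 hT
  · rw [sahiE3_comm₂₃]
    exact SahiTwoLevelIndep.prodBernoulli_sahiE3_nonneg_of_card_inter_le_one q (hU 0) (hU 2) (hU 1) h0 h2 hT

/-- **KAHN'S INEQUALITY ON EVERY RECURSIVELY CERTIFIED CLASS.**  Let `P S U` be a predicate on (coordinate set, triple) that always certifies one of: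
(a) an absorbing head; (d) two members determined by coordinate sets sharing at most one coin; (b) an inessential coordinate `e ∈ S` with
`P (S.erase e) U`; (c) a coordinate `e ∈ S` with top-absorbing `1`-sections and `P (S.erase e)` for both section triples; (g) a coordinate `e ∈ S`
whose sections lie in a solved face, with `P (S.erase e)` for all eight mixed section triples.  Then `E_3(μ_q; U) ≥ 0` for every increasing
triple determined by `S` with `P S U`. [this work] -/
theorem sahiE3_nonneg_of_recursivelyCertified (q : κ → unitInterval) (P : Finset κ → (Fin 3 → Set (Set κ)) → Prop)
    (hP : ∀ (S : Finset κ) (U : Fin 3 → Set (Set κ)), P S U →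
      (∃ i : Fin 3, ∀ ω : Set κ, (∀ k : Fin 3, k ≠ i → ω ∈ U k) → ω ∈ U i)
      ∨ (∃ T₀ T₁ : Finset κ, (T₀ ∩ T₁).card ≤ 1 ∧
          ((DeterminedBy (U 0) (↑T₀ : Set κ) ∧ DeterminedBy (U 1) (↑T₁ : Set κ))
            ∨ (DeterminedBy (U 1) (↑T₀ : Set κ) ∧ DeterminedBy (U 2) (↑T₁ : Set κ))
            ∨ (DeterminedBy (U 0) (↑T₀ : Set κ) ∧ DeterminedBy (U 2) (↑T₁ : Set κ))))
      ∨ (∃ e ∈ S, (∀ i, DeterminedBy (U i) (↑(S.erase e) : Set κ)) ∧ P (S.erase e) U)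
      ∨ (∃ e ∈ S,
          (secAt e true (U 1) ∩ secAt e true (U 2) ⊆ secAt e true (U 0)
            ∨ secAt e true (U 2) ∩ secAt e true (U 0) ⊆ secAt e true (U 1)
            ∨ secAt e true (U 0) ∩ secAt e true (U 1) ⊆ secAt e true (U 2))
          ∧ P (S.erase e) ![secAt e true (U 0), secAt e true (U 1), secAt e true (U 2)]
          ∧ P (S.erase e) ![secAt e false (U 0), secAt e false (U 1), secAt e false (U 2)])
      ∨ (∃ e ∈ S,
          InSolvedFace q ![secAt e true (U 0), secAt e true (U 1), secAt e true (U 2)]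
            ![secAt e false (U 0), secAt e false (U 1), secAt e false (U 2)]
          ∧ ∀ X : Fin 3 → Set (Set κ), (∀ i, ∃ j, X i = secAt e true (U j) ∨ X i = secAt e false (U j)) → P (S.erase e) X)) :
    ∀ (S : Finset κ) (U : Fin 3 → Set (Set κ)), P S U → (∀ i, IsUpperSet (U i)) → (∀ i, DeterminedBy (U i) (↑S : Set κ)) →
      0 ≤ sahiE3 (prodBernoulli q) (U 0) (U 1) (U 2) := by
  suffices key : ∀ (m : ℕ) (S : Finset κ) (U : Fin 3 → Set (Set κ)), S.card = m → P S U → (∀ i, IsUpperSet (U i)) →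
      (∀ i, DeterminedBy (U i) (↑S : Set κ)) → 0 ≤ sahiE3 (prodBernoulli q) (U 0) (U 1) (U 2) from
    fun S U hPU hU hUS => key _ S U rfl hPU hU hUS
  intro m
  induction m using Nat.strong_induction_on with
  | _ m ih =>
  intro S U hS hPU hU hUS
  rcases hP S U hPU with ⟨i, hi⟩ | ⟨T₀, T₁, hT, hdet⟩ | ⟨e, heS, hdet, hPe⟩ | ⟨e, heS, habs, hP1, hP0⟩ | ⟨e, heS, hface, hPX⟩
  · -- (a) absorbing head
    refine SahiAbsorbed.kahn_sahiE3_nonneg_of_inter_subset q (U 0) (U 1) (U 2) (hU 0) (hU 1) (hU 2) i fun ω hω => ?_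
    have h := hi ω fun k hk => by
      have := hω k hk
      fin_cases k <;> simpa using this
    fin_cases i <;> simpa using h
  · -- (d) two members share at most one coin
    exact sahiE3_nonneg_of_sharedLeOne q U hU T₀ T₁ hT hdet
  · -- (b) inessential coordinate
    have hlt : (S.erase e).card < m := by rw [← hS]; exact Finset.card_erase_lt_of_mem heS
    exact ih _ hlt (S.erase e) U rfl hPe hU hdet
  · -- (c) top-absorbing coordinate
    have hlt : (S.erase e).card < m := by rw [← hS]; exact Finset.card_erase_lt_of_mem heS
    have h1 : 0 ≤ sahiE3 (prodBernoulli q) (secAt e true (U 0)) (secAt e true (U 1)) (secAt e true (U 2)) := by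
      have := ih _ hlt (S.erase e) ![secAt e true (U 0), secAt e true (U 1), secAt e true (U 2)] rfl hP1
        (fun i => by fin_cases i <;> exact isUpperSet_secAt e true (hU _))
        (fun i => by fin_cases i <;> exact determinedBy_secAt e true (hUS _))
      simpa using this
    have h0 : 0 ≤ sahiE3 (prodBernoulli q) (secAt e false (U 0)) (secAt e false (U 1)) (secAt e false (U 2)) := by
      have := ih _ hlt (S.erase e) ![secAt e false (U 0), secAt e false (U 1), secAt e false (U 2)] rfl hP0
        (fun i => by fin_cases i <;> exact isUpperSet_secAt e false (hU _))
        (fun i => by fin_cases i <;> exact determinedBy_secAt e false (hUS _))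
      simpa using this
    exact sahiE3_nonneg_of_topAbsorbingAt q e (hU 0) (hU 1) (hU 2) habs h0 h1
  · -- (g) solved-face coordinate: all eight mixed section triples by induction
    have hlt : (S.erase e).card < m := by rw [← hS]; exact Finset.card_erase_lt_of_mem heS
    have hE : MixedE3Nonneg q ![secAt e true (U 0), secAt e true (U 1), secAt e true (U 2)]
        ![secAt e false (U 0), secAt e false (U 1), secAt e false (U 2)] := by
      intro X hX
      have hX' : ∀ i, ∃ j, X i = secAt e true (U j) ∨ X i = secAt e false (U j) := by
        intro i; obtain ⟨j, hj | hj⟩ := hX i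
        · exact ⟨j, Or.inl (by rw [hj, secTriple_apply])⟩
        · exact ⟨j, Or.inr (by rw [hj, secTriple_apply])⟩
      have hup : ∀ i, IsUpperSet (X i) := by
        intro i; obtain ⟨j, hj | hj⟩ := hX' i <;> rw [hj]
        · exact isUpperSet_secAt e true (hU j)
        · exact isUpperSet_secAt e false (hU j)
      have hdet : ∀ i, DeterminedBy (X i) (↑(S.erase e) : Set κ) := by
        intro i; obtain ⟨j, hj | hj⟩ := hX' i <;> rw [hj]
        · exact determinedBy_secAt e true (hUS j)
        · exact determinedBy_secAt e false (hUS j)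
      exact ih _ hlt (S.erase e) X rfl (hPX X hX') hup hdet
    exact sahiE3_nonneg_of_solvedFaceAt q e U hU hface hE

end SahiTwoLevelVariational

end Summit.CriticalPhenomena.PercolationContinuityZ3.Theorems
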